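import Literature.AnabelianGeometry.AbsoluteAnabelian.MLFReciprocityEquivariantProofs
import HarnessLib

/-!
# The reciprocity map of a finite Galois subextension, CHARACTERISED on Weil representatives

Sequel of `MLFReciprocityEquivariantProofs.lean` (abc-iut-L6-t11): the same `Art : E₀ˣ → Gal(F̄/E₀)^ab`
(Serre's `θ_E` read in the Weil datum of `F` and transported along `Gal(F̄/E₀) ≅ Γ_E`), with a fourth
clause making it COMPUTABLE from Neukirch's reciprocity map of the datum: if `w ∈ W_F ∩ G_{E₀}`
satisfies `r_{U_E, V'}(w) = [ι⁻¹ u]` for every finite abelian `L'/E` (`V' = W_F ∩ G_{ι⁻¹L'}`), then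
`Art u = [toAbsGalois w]`.  This is the interface the local transfer theorem (Neukirch IV (5.9) at
the level of `θ_E`, files `AbstractReciprocityTransfer` / `LocalReciprocityTransferFinite` /
`VerlagerungWeilReps`) consumes.  Proof-only; the construction is abc-iut-L6-t11's, repeated.
[AbsAnab] §1.2 p. 9; Neukirch IV (5.6), (6.3). HONEST FRAMING: classical LCFT; no bearing on
[IUTchIII] Cor. 3.12.
-/

noncomputable section

open Field IsNonarchimedeanLocalField ValuativeRel
open scoped Pointwise

namespace Literature.AnabelianGeometry.AbsoluteAnabelian

open Literature.NumberTheory.GaloisRepresentations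
open Literature.NumberTheory.GaloisRepresentations.LocalWeilDatum
open AbstractCFT AbstractCFT.WeilDatum

section Package

variable (F E : Type*) [Field F] [ValuativeRel F] [TopologicalSpace F] [IsNonarchimedeanLocalField F]
  [Field E] [Algebra F E] [FiniteDimensional F E] [Algebra.IsSeparable F E] [Normal F E]
  [ValuativeRel E] [TopologicalSpace E] [IsNonarchimedeanLocalField E] [ValuativeExtension F E]

/-- **The reciprocity map of the finite Galois subextension `E₀ = ι⁻¹(E) ⊆ F̄`, with values in
`Gal(F̄/E₀)^ab` and its `Γ_F`-equivariance** (Neukirch IV (5.8), functoriality of the norm residue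
symbol under `σ : L|K → σL|σK`, here for the inner automorphisms of `Γ_F`): there is a homomorphism
`Art : E₀ˣ → Gal(F̄/E₀)^ab` which is injective, whose image contains every torsion element, and
such that `Art (g u) = g̃ Art(u) g̃⁻¹` for `g ∈ Γ_F` — stated relationally: if `u' = g • u` and
`h' = g h g⁻¹` then `Art u = [h] → Art u' = [h']`.  `Art` is Serre's `θ_E` (read inside the Weil
datum of `F`, `recSystemE`) transported along `Gal(F̄/E₀) ≅ Γ_E`; injectivity and the torsion clause
are `IsLocalReciprocityMap` (`θ_E(U_E) = [I_E] ⊇` torsion, as `Γ_E/I_E ≅ Ẑ` is torsion-free and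
`[Γ_E,Γ_E]⁻ ≤ I_E`); equivariance is `absGaloisAbProj_eq_theta_of_conj` for `ρ ∈ W_F` plus density
of `W_F` in `Γ_F` (`g = ρ k`, `k ∈ G_{E₀}` acts trivially on `E₀` and by an inner automorphism on
`Gal(F̄/E₀)^ab`).  FOURTH/FIFTH CLAUSES (this file): `Art u = [h]` iff `h`'s lift to `Γ_E` restricts to the norm
residue symbols `(ι⁻¹u, L'/E)` on every finite abelian `L'`, and, for a Weil element `w ∈ W_F ∩ G_{E₀}`,
`Art u = [w]` iff `r_{U_E,V'}(w) = [ι⁻¹ u]` for every finite abelian `L'/E` (`recSystemE_eq_weilRestrictE_iff` + the characterisation of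
`θ_E` by its finite shadows, `IsReciprocitySystem.absGaloisAbProj_eq_theta_iff`).
[cite: NeukirchANT1999, Ch. IV Prop. (5.8)] -/
theorem exists_reciprocity_characterized_embField :
    ∃ Art : (embField F E)ˣ →* TopologicalAbelianization (galFixing F (embField F E)),
      Function.Injective Art ∧
      (∀ t, IsOfFinOrder t → t ∈ Set.range Art) ∧
      (∀ (g : absoluteGaloisGroup F) (u u' : (embField F E)ˣ) (h h' : galFixing F (embField F E)),
        ((u' : embField F E) : AlgebraicClosure F) = g • ((u : embField F E) : AlgebraicClosure F) →
        (h' : absoluteGaloisGroup F) = g * h * g⁻¹ →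
        Art u = QuotientGroup.mk h → Art u' = QuotientGroup.mk h') ∧
      (∀ (u : (embField F E)ˣ) (h : galFixing F (embField F E)),
        Art u = QuotientGroup.mk h ↔
          ∀ (L' : IntermediateField E (AlgebraicClosure E)) [FiniteDimensional E L']
              [IsAbelianGalois E L'],
            AlgEquiv.restrictNormalHom L' (absoluteGaloisGroup.toAlgEquiv E (liftGal F E h.2)) =
              recSystemE (isClassFieldTheory_localWeilDatum F) L'
                (Units.map ((equivEmbField F E).symm : embField F E →* E) u)) ∧
      ∀ (u : (embField F E)ˣ) (w : fieldSubgroup F (embField F E)),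
        Art u = QuotientGroup.mk (toGalFixing F (embField F E) w) ↔
          ∀ (L' : IntermediateField E (AlgebraicClosure E)) [FiniteDimensional E L']
              [IsAbelianGalois E L'],
            (localWeilDatum F).recMap (fieldSubgroup F (embField F E))
                (fieldSubgroup F (embFieldOf F E L')) w =
              QuotientGroup.mk (unitE F E (Units.map ((equivEmbField F E).symm : embField F E →* E) u)) := by
  classical
  set hcf := isClassFieldTheory_localWeilDatum F
  set hω := isReciprocitySystemE (F := F) (E := E) hcf
  have hθ : IsLocalReciprocityMap E hω.theta :=
    hω.isLocalReciprocityMap_theta (universalNormSubgroup_eq_bot E) (isClosed_of_isNormSubgroup_holds E)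
  obtain ⟨Φ, hΦ⟩ := exists_continuousMulEquiv_galFixing_embField F E
  obtain ⟨ê, hê⟩ := exists_mulEquiv_topologicalAbelianization Φ
  let eE : E ≃ₐ[F] embField F E := equivEmbField F E
  let Art : (embField F E)ˣ →* TopologicalAbelianization (galFixing F (embField F E)) :=
    ê.symm.toMonoidHom.comp (hω.theta.comp (Units.map (eE.symm : embField F E →* E)))
  have hArt : ∀ u, Art u = ê.symm (hω.theta (Units.map (eE.symm : embField F E →* E) u)) := fun _ => rfl
  -- `Art u = [h] ↔ θ (ι u) = [liftGal h]`
  have hArt_eq : ∀ (u : (embField F E)ˣ) (h : galFixing F (embField F E)),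
      Art u = QuotientGroup.mk h ↔
        absGaloisAbProj E (liftGal F E h.2) = hω.theta (Units.map (eE.symm : embField F E →* E) u) := by
    intro u h
    rw [hArt, MulEquiv.symm_apply_eq, hê, hΦ, eq_comm]
    exact Iff.rfl
  refine ⟨Art, ?_, ?_, ?_, ?_, ?_⟩
  · -- injective
    intro u v huv
    rw [hArt, hArt] at huv
    have h1 := hθ.injective (ê.symm.injective huv)
    have h2 : (Units.map (eE.symm : embField F E →* E)) u = (Units.map (eE.symm : embField F E →* E)) v := h1
    exact (Units.map_injective (f := (eE.symm : embField F E →* E)) eE.symm.injective) h2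
  · -- torsion elements are in the range: they come from `[I_E] = θ(U_E)`
    intro t ht
    obtain ⟨n, hn, htn⟩ := isOfFinOrder_iff_pow_eq_one.mp ht
    have hCI : (commutator (absoluteGaloisGroup E)).topologicalClosure ≤ absInertia E :=
      WeilGroup.topologicalClosure_commutator_absGalois_le_absInertia
        (WeilGroup.denseRange_toAbsGalois_holds E)
    obtain ⟨σ, hσ⟩ := QuotientGroup.mk_surjective (ê t)
    have hσn : σ ^ n ∈ absInertia E := by
      apply hCI
      rw [← QuotientGroup.eq_one_iff, QuotientGroup.mk_pow, hσ, ← map_pow, htn, map_one]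
    have hσI : σ ∈ absInertia E := mem_absInertia_of_pow_mem hn hσn
    have hmem : (QuotientGroup.mk σ : absoluteGaloisGroupAbelianization E) ∈
        ((absInertia E).map (absGaloisAbProj E)) := ⟨σ, hσI, rfl⟩
    rw [← hθ.map_unitGroup] at hmem
    obtain ⟨v, -, hv⟩ := hmem
    refine ⟨Units.map (eE : E →* embField F E) v, ?_⟩
    rw [hArt, MulEquiv.symm_apply_eq, ← hσ, ← hv]
    congr 1
    ext
    simp [eE]
  · -- equivariance
    intro g u u' h h' hu hh' hArt_u
    haveI := finiteDimensional_embField F E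
    -- density: `ρ̂ = g k` with `ρ ∈ W_F`, `k ∈ G_{E₀}`
    obtain ⟨ρ, hρ⟩ := exists_toAbsGalois_mem_smul_galFixing F (embField F E) g
    obtain ⟨k, hk, hgk⟩ := Set.mem_smul_set.mp hρ
    rw [smul_eq_mul] at hgk
    -- replace `h` by `k⁻¹ h k` (same class in the abelianisation) and `g` by `ρ̂ = g k`
    let h₁ : galFixing F (embField F E) := ⟨k⁻¹ * h * k, mul_mem (mul_mem (inv_mem hk) h.2) hk⟩
    have hcls : (QuotientGroup.mk h : TopologicalAbelianization (galFixing F (embField F E))) =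
        QuotientGroup.mk h₁ := by
      have : h₁ = (⟨k, hk⟩ : galFixing F (embField F E))⁻¹ * h * ⟨k, hk⟩ := Subtype.ext rfl
      rw [this, QuotientGroup.mk_mul, QuotientGroup.mk_mul, QuotientGroup.mk_inv, inv_mul_cancel_comm]
    have hu' : ((u' : embField F E) : AlgebraicClosure F) =
        WeilGroup.toAbsGalois F ρ • ((u : embField F E) : AlgebraicClosure F) := by
      rw [hu, ← hgk, mul_smul, (mem_galFixing_iff F).mp hk _ (u : embField F E).2]
    have hh₁' : (h' : absoluteGaloisGroup F) =
        WeilGroup.toAbsGalois F ρ * h₁ * (WeilGroup.toAbsGalois F ρ)⁻¹ := by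
      change (h' : absoluteGaloisGroup F) =
        WeilGroup.toAbsGalois F ρ * (k⁻¹ * h * k) * (WeilGroup.toAbsGalois F ρ)⁻¹
      rw [hh', ← hgk]
      group
    rw [hcls] at hArt_u
    -- the conjugation data of `ρ̂`
    obtain ⟨φ, hφι⟩ := exists_ringEquiv_conj_absClosureEmbedding F E (WeilGroup.toAbsGalois F ρ)
    obtain ⟨γ, hφ⟩ := exists_ringEquiv_semilinear F E hφι
    -- `ι u' = γ (ι u)` in `E`
    have hγu : Units.map (eE.symm : embField F E →* E) u' =
        Units.map (γ : E →* E) (Units.map (eE.symm : embField F E →* E) u) := by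
      ext
      apply (algebraMap E (AlgebraicClosure E)).injective
      change algebraMap E (AlgebraicClosure E) (eE.symm (u' : embField F E)) =
        algebraMap E (AlgebraicClosure E) (γ (eE.symm (u : embField F E)))
      rw [← hφ, ← absClosureEmbedding_coe_eq, ← absClosureEmbedding_coe_eq, hu', hφι]
    -- apply the `W_F`-equivariance of `θ_E`
    have hmem' : WeilGroup.toAbsGalois F ρ * (h₁ : absoluteGaloisGroup F) * (WeilGroup.toAbsGalois F ρ)⁻¹ ∈
        galFixing F (embField F E) := conj_mem_galFixing F E _ h₁.2
    have key := absGaloisAbProj_eq_theta_of_conj hcf ρ hφι hφ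
      (Units.map (eE.symm : embField F E →* E) u) (σ := liftGal F E h₁.2) (σ' := liftGal F E hmem')
      (absGaloisRestrict_liftGal_conj F E _ h₁.2 hmem') ((hArt_eq u h₁).mp hArt_u)
    have hh'eq : h' = ⟨_, hmem'⟩ := Subtype.ext hh₁'
    rw [hh'eq, hArt_eq, hγu]
    exact key
  · -- characterisation by the finite abelian shadows of `θ_E`
    intro u h
    rw [hArt_eq, hω.absGaloisAbProj_eq_theta_iff, IsReciprocitySystem.mem_reps_iff]
  · -- characterisation on Weil representatives through Neukirch's reciprocity map
    intro u w
    rw [hArt_eq, hω.absGaloisAbProj_eq_theta_iff, IsReciprocitySystem.mem_reps_iff]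
    have h1 : liftGal F E (toGalFixing F (embField F E) w).2 =
        liftGal F E ((toAbsGalois_mem_galFixing_iff (F := F)).mpr w.2) := rfl
    refine ⟨fun hR L' _ _ => ?_, fun hW L' _ _ => ?_⟩
    · have := hR L'
      rw [h1, ← weilRestrictE_apply] at this
      exact (recSystemE_eq_weilRestrictE_iff hcf L' _ w).mp this.symm
    · rw [h1, ← weilRestrictE_apply]
      exact ((recSystemE_eq_weilRestrictE_iff hcf L' _ w).mpr (hW L')).symm

end Package

end Literature.AnabelianGeometry.AbsoluteAnabelian
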